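import Mathlib
import HarnessLib
import Literature.Probability.LatticeModels.IsingThermodynamics
import Literature.Probability.LatticeModels.ThermodynamicLimit
import Summits.CriticalPhenomena.Ising3DConformalLimit.Theorems.PrecisionLaplacianDirectCorrelationStableTailSlabModeExpDecayCrossAssemblyAux

/-!
# Cross assembly, auxiliary file 2: the frame geometry at a point of a sharp-momentum line
# (sub-stub `stub_slabModeExpDecay_auxCrossAssembly` of line `self-energy-pick-inversion`)

Crux `PrecisionLaplacian.DirectCorrelationStableTail` (stmt-CriticalPhenomena-4799), parent stub
`stub_slabModeExpDecay` (the transverse mass gap), brick `stub_slabModeExpDecay_auxCrossAssembly`.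

Fix a direction `i`, a good reduced transverse momentum `k` (`|k_j| < π`, `K = ‖k‖_∞ > 0`) and a
real `θ`; put `P = ins_i(θ, k) ∈ ℝ³`.  LINE HOLOMORPHY (a hypothesis, text of the lead's interface
`lineHolomorphy_SHAPE`, for an abstract function `g : ℝ³ → ℝ`): for all margins `d, m > 0` there is
a bound `B` such that along every frame line `{p + t w_u}` (`u ∈ {eᵢ} ∪ {eᵢ ± eⱼ}`, `w_u = u/|u|²`)
with `dist(p·u, 2πℤ) ≥ d` and sup-distance `≥ m` from `(2πℤ)³`, `t ↦ g(p + t w_u)` continues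
holomorphically to the disc `|t| < c₀ d` with bound `B`.  We produce a holomorphic continuation of
`s ↦ g(ins_i(s, k))` to a disc around `θ` of radius proportional to `K`:

* Case A (`dist(θ, 2πℤ) ≥ K/4`, `exists_local_extension_of_far` in the main file
  `…CrossAssembly`): the axis line `u = eᵢ` through `P` itself is admissible, radius `c₀ K/4`;
* `exists_local_extension_of_near` (Case B, `dist(θ, 2πℤ) < K/4`; registered as
  `stub_slabModeExpDecay_auxCrossAssembly3`): with `a` the slot of the largest `|k|`-coordinate
  (`|P_a| = K`), the diagonal frames `u₊ = eᵢ + eₐ`, `u₋ = eᵢ - eₐ` have `P·u_± = θ ± P_a` at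
  distance `≥ 3K/4` from `2πℤ`, and the `u_±`-lines through all points of the small parallelogram
  `P + r[-1,1]w₊ + r[-1,1]w₋`, `r = min(c₀,1)K/4`, stay at sup-distance `≥ K/4` from `(2πℤ)³`
  (two coordinates control the sup norm).  Line holomorphy along these two families of lines is
  exactly the input of `exists_diagonal_extension_of_two_lines` (file `…CrossAssemblyAux`): the
  cross lemma continues `g` along the diagonal `w₊ + w₋ = eᵢ`, radius `min(c₀,1) min(ρ,1) K/4`.

Pure theorem file, no definitions, no `sorry`.  References: Jarnicki–Pflug, *Extension of
Holomorphic Functions*, Ch. 5 [JarnickiPflug2011] (cross theorem); the frame list is the nine-frame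
reflection positivity of the nearest-neighbour model.
-/

noncomputable section

namespace Summit.CriticalPhenomena.Ising3DConformalLimit.Cruxes.DirectCorrelationStableTail.SelfEnergyPickInversion

open MeasureTheory Filter Topology Complex Metric Set
open scoped BigOperators Real
open Literature.Probability.LatticeModels

/-! ### Frame vectors -/

/-- Coordinates of the axis frame `eᵢ`. [folklore] -/
theorem frame_single_apply (i j : Fin 3) :
    (((Pi.single i 1 : Site 3) j : ℤ) : ℝ) = if j = i then 1 else 0 := by
  simp [Pi.single_apply]

/-- Coordinates of the diagonal frame `eᵢ + eₐ`. [folklore] -/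
theorem frame_add_apply (i a j : Fin 3) :
    (((Pi.single i 1 + Pi.single a 1 : Site 3) j : ℤ) : ℝ) =
      (if j = i then 1 else 0) + (if j = a then 1 else 0) := by
  simp [Pi.single_apply]

/-- Coordinates of the diagonal frame `eᵢ - eₐ`. [folklore] -/
theorem frame_sub_apply (i a j : Fin 3) :
    (((Pi.single i 1 - Pi.single a 1 : Site 3) j : ℤ) : ℝ) =
      (if j = i then 1 else 0) - (if j = a then 1 else 0) := by
  simp [Pi.single_apply]

/-- `|eᵢ|² = 1`. [folklore] -/
theorem frame_single_sum_sq (i : Fin 3) :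
    ∑ l, (((Pi.single i 1 : Site 3) l : ℤ) : ℝ) ^ 2 = 1 := by
  simp [Pi.single_apply, Finset.sum_ite_eq']

/-- `|eᵢ + eₐ|² = 2` for `i ≠ a`. [folklore] -/
theorem frame_add_sum_sq {i a : Fin 3} (h : i ≠ a) :
    ∑ l, (((Pi.single i 1 + Pi.single a 1 : Site 3) l : ℤ) : ℝ) ^ 2 = 2 := by
  fin_cases i <;> fin_cases a <;> simp (config := {decide := true}) at h ⊢ <;>
    simp [Fin.sum_univ_three, Pi.single_apply] <;> norm_num

/-- `|eᵢ - eₐ|² = 2` for `i ≠ a`. [folklore] -/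
theorem frame_sub_sum_sq {i a : Fin 3} (h : i ≠ a) :
    ∑ l, (((Pi.single i 1 - Pi.single a 1 : Site 3) l : ℤ) : ℝ) ^ 2 = 2 := by
  fin_cases i <;> fin_cases a <;> simp (config := {decide := true}) at h ⊢ <;>
    simp [Fin.sum_univ_three, Pi.single_apply] <;> norm_num

/-- `p·eᵢ = pᵢ`. [folklore] -/
theorem frame_single_dot (i : Fin 3) (p : Fin 3 → ℝ) :
    ∑ j, p j * (((Pi.single i 1 : Site 3) j : ℤ) : ℝ) = p i := by
  simp [Pi.single_apply, Finset.sum_ite_eq']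

/-- `p·(eᵢ + eₐ) = pᵢ + pₐ`. [folklore] -/
theorem frame_add_dot (i a : Fin 3) (p : Fin 3 → ℝ) :
    ∑ j, p j * (((Pi.single i 1 + Pi.single a 1 : Site 3) j : ℤ) : ℝ) = p i + p a := by
  simp [Pi.single_apply, mul_add, Finset.sum_add_distrib, Finset.sum_ite_eq']

/-- `p·(eᵢ - eₐ) = pᵢ - pₐ`. [folklore] -/
theorem frame_sub_dot (i a : Fin 3) (p : Fin 3 → ℝ) :
    ∑ j, p j * (((Pi.single i 1 - Pi.single a 1 : Site 3) j : ℤ) : ℝ) = p i - p a := by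
  simp [Pi.single_apply, mul_sub, Finset.sum_sub_distrib, Finset.sum_ite_eq']

/-! ### Line margins from two coordinates -/

/-- If `uᵢ = uₐ = 1`, the `u`-line through `b` stays at sup-distance `≥ m` from `(2πℤ)³` as soon as
`dist(bᵢ - bₐ, 2πℤ) ≥ 2m` (the parameter cancels in `vᵢ - vₐ`). [folklore] -/
theorem le_norm_line_of_sub {u : Site 3} {i a : Fin 3} (hui : ((u i : ℤ) : ℝ) = 1)
    (hua : ((u a : ℤ) : ℝ) = 1) {b : Fin 3 → ℝ} {m : ℝ}
    (h : ∀ n : ℤ, 2 * m ≤ |b i - b a - 2 * Real.pi * n|) (t : ℝ) (L : Fin 3 → ℤ) :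
    m ≤ ‖(fun j => b j + t * ((u j : ℝ) / ∑ l, ((u l : ℝ)) ^ 2) - 2 * Real.pi * (L j : ℝ))‖ := by
  set v : Fin 3 → ℝ := fun j => b j + t * ((u j : ℝ) / ∑ l, ((u l : ℝ)) ^ 2) -
    2 * Real.pi * (L j : ℝ) with hv
  have h2 := abs_sub_le_two_mul_norm v i a
  have h3 : v i - v a = b i - b a - 2 * Real.pi * ((L i - L a : ℤ) : ℝ) := by
    simp only [hv, hui, hua]; push_cast; ring
  have h4 := h (L i - L a)
  rw [← h3] at h4
  linarith

/-- If `uᵢ = 1`, `uₐ = -1`, the `u`-line through `b` stays at sup-distance `≥ m` from `(2πℤ)³` as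
soon as `dist(bᵢ + bₐ, 2πℤ) ≥ 2m` (the parameter cancels in `vᵢ + vₐ`). [folklore] -/
theorem le_norm_line_of_add {u : Site 3} {i a : Fin 3} (hui : ((u i : ℤ) : ℝ) = 1)
    (hua : ((u a : ℤ) : ℝ) = -1) {b : Fin 3 → ℝ} {m : ℝ}
    (h : ∀ n : ℤ, 2 * m ≤ |b i + b a - 2 * Real.pi * n|) (t : ℝ) (L : Fin 3 → ℤ) :
    m ≤ ‖(fun j => b j + t * ((u j : ℝ) / ∑ l, ((u l : ℝ)) ^ 2) - 2 * Real.pi * (L j : ℝ))‖ := by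
  set v : Fin 3 → ℝ := fun j => b j + t * ((u j : ℝ) / ∑ l, ((u l : ℝ)) ^ 2) -
    2 * Real.pi * (L j : ℝ) with hv
  have h2 := abs_add_le_two_mul_norm v i a
  have h3 : v i + v a = b i + b a - 2 * Real.pi * ((L i + L a : ℤ) : ℝ) := by
    simp only [hv, hui, hua]; push_cast; ring
  have h4 := h (L i + L a)
  rw [← h3] at h4
  linarith

/-! ### One arm: rescaling a line continuation to the disc `|t| < 2` -/

/-- **Rescaled arm.** Line holomorphy at a base point `b` along the frame `u` with margins `(d, m)`
and `2r ≤ c₀ d` gives a continuation of `t ↦ g(b + t · r w_u)` to the disc `|t| < 2`, with the same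
bound. [folklore] -/
theorem exists_arm_of_lineHol {g : (Fin 3 → ℝ) → ℝ} {c₀ d m B r : ℝ} {u : Site 3}
    (hB : ∀ u : Site 3, ((∃ i : Fin 3, u = Pi.single i 1) ∨
          ∃ i j : Fin 3, i ≠ j ∧ (u = Pi.single i 1 + Pi.single j 1 ∨ u = Pi.single i 1 - Pi.single j 1)) →
      ∀ p : Fin 3 → ℝ, (∀ n : ℤ, d ≤ |(∑ j, p j * (u j : ℝ)) - 2 * Real.pi * n|) →
        (∀ (t : ℝ) (L : Fin 3 → ℤ), m ≤ ‖(fun j => p j + t * ((u j : ℝ) / ∑ l, ((u l : ℝ)) ^ 2)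
          - 2 * Real.pi * (L j : ℝ))‖) →
        ∃ F : ℂ → ℂ, DifferentiableOn ℂ F (Metric.ball (0 : ℂ) (c₀ * d)) ∧
          (∀ s : ℝ, |s| < c₀ * d →
            F (s : ℂ) = ((g (fun j => p j + s * ((u j : ℝ) / ∑ l, ((u l : ℝ)) ^ 2)) : ℝ) : ℂ)) ∧
          (∀ z : ℂ, ‖z‖ < c₀ * d → ‖F z‖ ≤ B))
    (hu : (∃ i : Fin 3, u = Pi.single i 1) ∨
      ∃ i j : Fin 3, i ≠ j ∧ (u = Pi.single i 1 + Pi.single j 1 ∨ u = Pi.single i 1 - Pi.single j 1))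
    (hr0 : 0 < r) (hrc : 2 * r ≤ c₀ * d) {b : Fin 3 → ℝ}
    (hbd : ∀ n : ℤ, d ≤ |(∑ j, b j * (u j : ℝ)) - 2 * Real.pi * n|)
    (hbm : ∀ (t : ℝ) (L : Fin 3 → ℤ), m ≤ ‖(fun j => b j + t * ((u j : ℝ) / ∑ l, ((u l : ℝ)) ^ 2)
      - 2 * Real.pi * (L j : ℝ))‖) :
    ∃ F : ℂ → ℂ, DifferentiableOn ℂ F (Metric.ball (0 : ℂ) 2) ∧
      (∀ t : ℝ, |t| < 2 →
        F t = (g (fun j => b j + t * (r * ((u j : ℝ) / ∑ l, ((u l : ℝ)) ^ 2))) : ℂ)) ∧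
      ∀ z : ℂ, ‖z‖ < 2 → ‖F z‖ ≤ B := by
  obtain ⟨F₀, hF₀d, hF₀t, hF₀b⟩ := hB u hu b hbd hbm
  have hmaps : ∀ z : ℂ, ‖z‖ < 2 → ‖(r : ℂ) * z‖ < c₀ * d := fun z hz => by
    rw [norm_mul, Complex.norm_real, Real.norm_eq_abs, abs_of_pos hr0]
    nlinarith
  refine ⟨fun z => F₀ (r * z), ?_, ?_, ?_⟩
  · refine hF₀d.comp ((differentiableOn_id).const_mul _) fun z hz => ?_
    simpa using hmaps z (by simpa using hz)
  · intro t ht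
    have hrt : |r * t| < c₀ * d := by
      rw [abs_mul, abs_of_pos hr0]; nlinarith
    show F₀ ((r : ℂ) * t) = _
    rw [← Complex.ofReal_mul, hF₀t (r * t) hrt]
    congr 2
    funext j
    ring
  · intro z hz
    exact hF₀b _ (hmaps z hz)

/-! ### Case B: `θ` close to `2πℤ` -/

/-- **Case B.** If `dist(θ, 2πℤ) < K/4` (`K = ‖k‖_∞ = |k_{a'}| > 0`, `|k_j| < π`), line holomorphy
along the two diagonal frames `eᵢ ± eₐ` (`a` the slot of `k_{a'}`) near `ins_i(θ, k)` and the cross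
lemma continue `s ↦ g(ins_i(s, k))` holomorphically to the disc `B(θ, min(c₀,1) min(ρ,1) K/4)`.
[folklore] -/
theorem exists_local_extension_of_near {g : (Fin 3 → ℝ) → ℝ} {c₀ ρ : ℝ} (hc₀ : 0 < c₀) (hρ : 0 < ρ)
    (hLH : ∀ (d m : ℝ), 0 < d → 0 < m → ∃ B : ℝ,
      ∀ u : Site 3, ((∃ i : Fin 3, u = Pi.single i 1) ∨
          ∃ i j : Fin 3, i ≠ j ∧ (u = Pi.single i 1 + Pi.single j 1 ∨ u = Pi.single i 1 - Pi.single j 1)) →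
      ∀ p : Fin 3 → ℝ, (∀ n : ℤ, d ≤ |(∑ j, p j * (u j : ℝ)) - 2 * Real.pi * n|) →
        (∀ (t : ℝ) (L : Fin 3 → ℤ), m ≤ ‖(fun j => p j + t * ((u j : ℝ) / ∑ l, ((u l : ℝ)) ^ 2)
          - 2 * Real.pi * (L j : ℝ))‖) →
        ∃ F : ℂ → ℂ, DifferentiableOn ℂ F (Metric.ball (0 : ℂ) (c₀ * d)) ∧
          (∀ s : ℝ, |s| < c₀ * d →
            F (s : ℂ) = ((g (fun j => p j + s * ((u j : ℝ) / ∑ l, ((u l : ℝ)) ^ 2)) : ℝ) : ℂ)) ∧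
          (∀ z : ℂ, ‖z‖ < c₀ * d → ‖F z‖ ≤ B))
    (hCross : ∀ (f : (Fin 3 → ℂ) → ℂ) (M : ℝ), (∀ (j : Fin 3) (a : Fin 3 → ℝ), (∀ i, |a i| ≤ 1) →
      DifferentiableOn ℂ (fun z : ℂ => f (Function.update (fun i => ((a i : ℝ) : ℂ)) j z))
        (Metric.ball (0 : ℂ) 2)) →
      (∀ (j : Fin 3) (a : Fin 3 → ℝ) (z : ℂ), (∀ i, |a i| ≤ 1) → ‖z‖ < 2 →
        ‖f (Function.update (fun i => ((a i : ℝ) : ℂ)) j z)‖ ≤ M) →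
      ∃ g : (Fin 3 → ℂ) → ℂ, AnalyticOnNhd ℂ g {z | ∀ i, ‖z i‖ < ρ} ∧
        (∀ z : Fin 3 → ℂ, (∀ i, ‖z i‖ < ρ) → ‖g z‖ ≤ M) ∧
        ∀ (j : Fin 3) (a : Fin 3 → ℝ) (z : ℂ), (∀ i, |a i| ≤ 1) → ‖z‖ < 2 →
          (∀ i, ‖Function.update (fun i => ((a i : ℝ) : ℂ)) j z i‖ < ρ) →
          g (Function.update (fun i => ((a i : ℝ) : ℂ)) j z) =
            f (Function.update (fun i => ((a i : ℝ) : ℂ)) j z))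
    (i : Fin 3) {k : Fin 2 → ℝ} (hk : ∀ j, |k j| < Real.pi) (hK : 0 < ‖k‖) {a' : Fin 2}
    (ha' : ‖k‖ ≤ |k a'|) {θ : ℝ} {n₀ : ℤ} (hθ : |θ - 2 * Real.pi * n₀| < ‖k‖ / 4) :
    ∃ Φ : ℂ → ℂ, DifferentiableOn ℂ Φ (Metric.ball (θ : ℂ) (min c₀ 1 * min ρ 1 * ‖k‖ / 4)) ∧
      ∀ s : ℝ, |s - θ| < min c₀ 1 * min ρ 1 * ‖k‖ / 4 → Φ s = ((g (Fin.insertNth i s k) : ℝ) : ℂ) := by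
  -- notation and elementary bounds
  set K : ℝ := ‖k‖ with hKdef
  have hKπ : K ≤ Real.pi :=
    ((pi_norm_lt_iff Real.pi_pos).mpr fun j => by rw [Real.norm_eq_abs]; exact hk j).le
  have hκ : |k a'| = K :=
    le_antisymm (by simpa [Real.norm_eq_abs] using norm_le_pi_norm k a') ha'
  have hκn : |(-k a')| = K := by rw [abs_neg, hκ]
  set a : Fin 3 := i.succAbove a' with hadef
  have hia : i ≠ a := (Fin.succAbove_ne i a').symm
  have hai : ¬ (a = i) := fun h => hia h.symm
  set r : ℝ := min c₀ 1 * K / 4 with hrdef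
  have hmin0 : 0 < min c₀ 1 := lt_min hc₀ one_pos
  have hr0 : 0 < r := by positivity
  have hrK : r ≤ K / 4 := by
    have : min c₀ 1 ≤ 1 := min_le_right _ _
    rw [hrdef]; nlinarith
  have hrc : 2 * r ≤ c₀ * (K / 2) := by
    have : min c₀ 1 ≤ c₀ := min_le_left _ _
    rw [hrdef]; nlinarith
  have hx0 : |(0 : ℝ)| ≤ K / 4 := by rw [abs_zero]; positivity
  obtain ⟨B, hB⟩ := hLH (K / 2) (K / 4) (by positivity) (by positivity)
  obtain ⟨P, hP⟩ : ∃ P : Fin 3 → ℝ, P = Fin.insertNth i θ k := ⟨_, rfl⟩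
  have hPi : P i = θ := by simp [hP]
  have hPa : P a = k a' := by simp [hP, hadef]
  -- the two frames `u₊ = eᵢ + eₐ`, `u₋ = eᵢ - eₐ` and their dual steps scaled by `r`
  set up : Site 3 := Pi.single i 1 + Pi.single a 1 with hup
  set um : Site 3 := Pi.single i 1 - Pi.single a 1 with hum
  have hUp : ∀ j, ((up j : ℤ) : ℝ) = (if j = i then 1 else 0) + (if j = a then 1 else 0) :=
    frame_add_apply i a
  have hUm : ∀ j, ((um j : ℤ) : ℝ) = (if j = i then 1 else 0) - (if j = a then 1 else 0) :=
    frame_sub_apply i a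
  have hSp : ∑ l, ((up l : ℤ) : ℝ) ^ 2 = 2 := frame_add_sum_sq hia
  have hSm : ∑ l, ((um l : ℤ) : ℝ) ^ 2 = 2 := frame_sub_sum_sq hia
  have hUpi : ((up i : ℤ) : ℝ) = 1 := by rw [hUp]; simp [hia]
  have hUpa : ((up a : ℤ) : ℝ) = 1 := by rw [hUp]; simp [hai]
  have hUmi : ((um i : ℤ) : ℝ) = 1 := by rw [hUm]; simp [hia]
  have hUma : ((um a : ℤ) : ℝ) = -1 := by rw [hUm]; simp [hai]
  obtain ⟨W₁, hW₁⟩ : ∃ W : Fin 3 → ℝ,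
      W = fun j => r * (((up j : ℤ) : ℝ) / ∑ l, ((up l : ℤ) : ℝ) ^ 2) := ⟨_, rfl⟩
  obtain ⟨W₂, hW₂⟩ : ∃ W : Fin 3 → ℝ,
      W = fun j => r * (((um j : ℤ) : ℝ) / ∑ l, ((um l : ℤ) : ℝ) ^ 2) := ⟨_, rfl⟩
  have hW₁i : W₁ i = r / 2 := by rw [hW₁]; simp only [hUpi, hSp]; ring
  have hW₁a : W₁ a = r / 2 := by rw [hW₁]; simp only [hUpa, hSp]; ring
  have hW₂i : W₂ i = r / 2 := by rw [hW₂]; simp only [hUmi, hSm]; ring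
  have hW₂a : W₂ a = -(r / 2) := by rw [hW₂]; simp only [hUma, hSm]; ring
  have hWsum : ∀ j, W₁ j + W₂ j = r * (if j = i then 1 else 0) := fun j => by
    rw [hW₁, hW₂]
    simp only
    rw [hSp, hSm, hUp j, hUm j]
    ring
  -- the arms in direction `u₊` through the base points `P + s W₂`
  have h₁ : ∀ s : ℝ, |s| ≤ 1 → ∃ F : ℂ → ℂ, DifferentiableOn ℂ F (Metric.ball (0 : ℂ) 2) ∧
      (∀ t : ℝ, |t| < 2 → F t = (g (fun j => P j + s * W₂ j + t * W₁ j) : ℂ)) ∧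
      ∀ z : ℂ, ‖z‖ < 2 → ‖F z‖ ≤ B := by
    intro s hs
    have hsr : |s * r| ≤ K / 4 := by
      rw [abs_mul, abs_of_pos hr0]; nlinarith
    obtain ⟨b, hb⟩ : ∃ b : Fin 3 → ℝ, b = fun j => P j + s * W₂ j := ⟨_, rfl⟩
    have hbd : ∀ n : ℤ, K / 2 ≤ |(∑ j, b j * ((up j : ℤ) : ℝ)) - 2 * Real.pi * n| := fun n => by
      have e : (∑ j, b j * ((up j : ℤ) : ℝ)) = θ + k a' + 0 := by
        rw [hup, frame_add_dot, hb]; simp only [hPi, hPa, hW₂i, hW₂a]; ring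
      rw [e]; exact half_le_abs_of_near hθ hκ hKπ hx0 n
    have hbm := le_norm_line_of_sub hUpi hUpa (b := b) (m := K / 4) fun n => by
      have e : b i - b a = θ + (-k a') + s * r := by
        rw [hb]; simp only [hPi, hPa, hW₂i, hW₂a]; ring
      rw [e]; linarith [half_le_abs_of_near hθ hκn hKπ hsr n]
    obtain ⟨F, hFd, hFt, hFb⟩ :=
      exists_arm_of_lineHol (g := g) hB (Or.inr ⟨i, a, hia, Or.inl rfl⟩) hr0 hrc hbd hbm
    refine ⟨F, hFd, fun t ht => ?_, hFb⟩
    rw [hFt t ht, hb, hW₁]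
  -- the arms in direction `u₋` through the base points `P + s W₁`
  have h₂ : ∀ s : ℝ, |s| ≤ 1 → ∃ F : ℂ → ℂ, DifferentiableOn ℂ F (Metric.ball (0 : ℂ) 2) ∧
      (∀ t : ℝ, |t| < 2 → F t = (g (fun j => P j + s * W₁ j + t * W₂ j) : ℂ)) ∧
      ∀ z : ℂ, ‖z‖ < 2 → ‖F z‖ ≤ B := by
    intro s hs
    have hsr : |s * r| ≤ K / 4 := by
      rw [abs_mul, abs_of_pos hr0]; nlinarith
    obtain ⟨b, hb⟩ : ∃ b : Fin 3 → ℝ, b = fun j => P j + s * W₁ j := ⟨_, rfl⟩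
    have hbd : ∀ n : ℤ, K / 2 ≤ |(∑ j, b j * ((um j : ℤ) : ℝ)) - 2 * Real.pi * n| := fun n => by
      have e : (∑ j, b j * ((um j : ℤ) : ℝ)) = θ + (-k a') + 0 := by
        rw [hum, frame_sub_dot, hb]; simp only [hPi, hPa, hW₁i, hW₁a]; ring
      rw [e]; exact half_le_abs_of_near hθ hκn hKπ hx0 n
    have hbm := le_norm_line_of_add hUmi hUma (b := b) (m := K / 4) fun n => by
      have e : b i + b a = θ + k a' + s * r := by
        rw [hb]; simp only [hPi, hPa, hW₁i, hW₁a]; ring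
      rw [e]; linarith [half_le_abs_of_near hθ hκ hKπ hsr n]
    obtain ⟨F, hFd, hFt, hFb⟩ :=
      exists_arm_of_lineHol (g := g) hB (Or.inr ⟨i, a, hia, Or.inr rfl⟩) hr0 hrc hbd hbm
    refine ⟨F, hFd, fun t ht => ?_, hFb⟩
    rw [hFt t ht, hb, hW₂]
  -- the cross lemma along the diagonal `W₁ + W₂ = r eᵢ`
  obtain ⟨Φ₀, hΦ₀d, hΦ₀t⟩ := exists_diagonal_extension_of_two_lines (g := g) (P := P) (w₁ := W₁)
    (w₂ := W₂) (B := B) hρ hCross h₁ h₂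
  have hR : min c₀ 1 * min ρ 1 * ‖k‖ / 4 = r * min ρ 1 := by rw [hrdef]; ring
  refine ⟨fun z => Φ₀ ((z - θ) / r), ?_, ?_⟩
  · rw [hR]
    refine hΦ₀d.comp ((differentiableOn_id.sub_const _).div_const _) fun z hz => ?_
    rw [mem_ball, dist_eq_norm] at hz
    rw [mem_ball, dist_zero_right, norm_div, Complex.norm_real, Real.norm_eq_abs, abs_of_pos hr0,
      div_lt_iff₀ hr0]
    linarith [mul_comm r (min ρ 1)]
  · intro s hs
    rw [hR] at hs
    have hs' : |(s - θ) / r| < min ρ 1 := by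
      rw [abs_div, abs_of_pos hr0, div_lt_iff₀ hr0]; linarith [mul_comm r (min ρ 1)]
    show Φ₀ (((s : ℂ) - θ) / r) = _
    rw [← Complex.ofReal_sub, ← Complex.ofReal_div, hΦ₀t _ hs']
    congr 2
    refine (Fin.insertNth_eq_iff.2 ⟨?_, ?_⟩).symm
    · rw [hWsum, hPi]; simp only [if_true]; field_simp; ring
    · funext l
      simp only [Fin.removeNth, hWsum, hP, Fin.insertNth_apply_succAbove, Fin.succAbove_ne, if_false]
      ring

/-- **Registered auxiliary stub `stub_slabModeExpDecay_auxCrossAssembly3`** (brick of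
`stub_slabModeExpDecay`, cross-assembly part, Case B at one point): under line holomorphy (constant
`c₀`) and the cross lemma (radius `ρ`) for an abstract `g : ℝ³ → ℝ`, at a real `θ` with
`dist(θ, 2πℤ) < ‖k‖/4` the function `s ↦ g(ins_i(s, k))` continues holomorphically to the disc
`B(θ, min(c₀,1) min(ρ,1) ‖k‖/4)` (`exists_local_extension_of_near`). [folklore] -/
theorem stub_slabModeExpDecay_auxCrossAssembly3 : ∀ (g : (Fin 3 → ℝ) → ℝ) (c₀ ρ : ℝ), 0 < c₀ → 0 < ρ →
    (∀ (d m : ℝ), 0 < d → 0 < m → ∃ B : ℝ,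
      ∀ u : Site 3, ((∃ i : Fin 3, u = Pi.single i 1) ∨
          ∃ i j : Fin 3, i ≠ j ∧ (u = Pi.single i 1 + Pi.single j 1 ∨ u = Pi.single i 1 - Pi.single j 1)) →
      ∀ p : Fin 3 → ℝ, (∀ n : ℤ, d ≤ |(∑ j, p j * (u j : ℝ)) - 2 * Real.pi * n|) →
        (∀ (t : ℝ) (L : Fin 3 → ℤ), m ≤ ‖(fun j => p j + t * ((u j : ℝ) / ∑ l, ((u l : ℝ)) ^ 2)
          - 2 * Real.pi * (L j : ℝ))‖) →
        ∃ F : ℂ → ℂ, DifferentiableOn ℂ F (Metric.ball (0 : ℂ) (c₀ * d)) ∧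
          (∀ s : ℝ, |s| < c₀ * d →
            F (s : ℂ) = ((g (fun j => p j + s * ((u j : ℝ) / ∑ l, ((u l : ℝ)) ^ 2)) : ℝ) : ℂ)) ∧
          (∀ z : ℂ, ‖z‖ < c₀ * d → ‖F z‖ ≤ B)) →
    (∀ (f : (Fin 3 → ℂ) → ℂ) (M : ℝ), (∀ (j : Fin 3) (a : Fin 3 → ℝ), (∀ i, |a i| ≤ 1) →
      DifferentiableOn ℂ (fun z : ℂ => f (Function.update (fun i => ((a i : ℝ) : ℂ)) j z))
        (Metric.ball (0 : ℂ) 2)) →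
      (∀ (j : Fin 3) (a : Fin 3 → ℝ) (z : ℂ), (∀ i, |a i| ≤ 1) → ‖z‖ < 2 →
        ‖f (Function.update (fun i => ((a i : ℝ) : ℂ)) j z)‖ ≤ M) →
      ∃ g : (Fin 3 → ℂ) → ℂ, AnalyticOnNhd ℂ g {z | ∀ i, ‖z i‖ < ρ} ∧
        (∀ z : Fin 3 → ℂ, (∀ i, ‖z i‖ < ρ) → ‖g z‖ ≤ M) ∧
        ∀ (j : Fin 3) (a : Fin 3 → ℝ) (z : ℂ), (∀ i, |a i| ≤ 1) → ‖z‖ < 2 →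
          (∀ i, ‖Function.update (fun i => ((a i : ℝ) : ℂ)) j z i‖ < ρ) →
          g (Function.update (fun i => ((a i : ℝ) : ℂ)) j z) =
            f (Function.update (fun i => ((a i : ℝ) : ℂ)) j z)) →
    ∀ (i : Fin 3) (k : Fin 2 → ℝ), (∀ j, |k j| < Real.pi) → 0 < ‖k‖ → ∀ a' : Fin 2, ‖k‖ ≤ |k a'| →
    ∀ (θ : ℝ) (n₀ : ℤ), |θ - 2 * Real.pi * n₀| < ‖k‖ / 4 →
    ∃ Φ : ℂ → ℂ, DifferentiableOn ℂ Φ (Metric.ball (θ : ℂ) (min c₀ 1 * min ρ 1 * ‖k‖ / 4)) ∧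
      ∀ s : ℝ, |s - θ| < min c₀ 1 * min ρ 1 * ‖k‖ / 4 → Φ s = ((g (Fin.insertNth i s k) : ℝ) : ℂ) :=
  fun _ _ _ hc₀ hρ hLH hCross i _ hk hK _ ha' _ _ hθ =>
    exists_local_extension_of_near hc₀ hρ hLH hCross i hk hK ha' hθ

end Summit.CriticalPhenomena.Ising3DConformalLimit.Cruxes.DirectCorrelationStableTail.SelfEnergyPickInversion

end
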